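/- Copyright: the b2b-balaban cell (near-miss cell 7), T⁴-continuum fan-out, NE7b swarm leaf 04 (gen 6; road W-RP, sub-row
«W3f» file 2 of 2: W3d's function-level hypotheses (LOC) and (VAR) DISCHARGED for Bałaban's block averaging (0.4) at one
level).  Released under the licence of the surrounding project. -/
import Literature.MathematicalPhysics.QuantumFieldTheory.Balaban1983to89.T4ReflectionConeSharp
import Summits.QuantumFields.BalabanUV.T4Continuum.Support.HistoryRPHalfTorus
import Summits.QuantumFields.BalabanUV.T4Continuum.Support.HistoryRPDeterministic

/-!
# History chessboard road: (LOC) and (VAR) of W3d DISCHARGED for the printed block averaging (0.4), one level (W3f, file 2)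

Summits-side support leaf of the T⁴-continuum cell (rung (B)+1 on a FINITE torus only; NOT infinite volume, NOT the
mass gap, NOT the Clay statement; NOT a proof of the spine estimate NE7b).  Road W-RP (formerly W-RP-VAR; R-OWNER-23-2,
R-OWNER-23-8) of the swarm claim table `t4/b2b-balaban-t4-ne7b-p1/LEAVES-NE7b.md`, sub-row «W3f» (GO l.15147, v3.39;
division of labour with W-CUTS (leaf-02 g8) l.15232: THIS file = the one-level junction for `avgFun ℰ` at the canonical
centre cut), on top of W3b (`HistoryRPExtension`), W3c (`HistoryRPBase`), W3d (`HistoryRPDeterministic`) and file 1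
(`HistoryRPHalfTorus`).  [folklore] bookkeeping over TREE theorems; no `structure`, no `[cite:]` tag of its own,
nothing printed asserted beyond what the imported tree modules carry, no `Prop`-valued definition (c1), no constant
(c2∕c6), no exit ∕ socket ∕ `HistoryConstants` file touched (c3).

WHY.  W3d (`rpPackage_level_deterministic`) reduces the RP-package of the δ-extended one-level state to the base package
plus TWO SENTENCES ABOUT THE AVERAGE MAPS relative to a reflection hyperplane: (i) `Measurable[mP] f` — the
positive-half block averages read positive-half fine variables ((LOC) for averages) — and (iii)
`g (θ p.1, p.2.swap) = τ (g p)` — the crossing averages intertwine the fine and the coarse reflections (= the covariance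
reading (γ) that R-OWNER-23-8 leaves displayed under (RP-ext)).  For the tree's typing of the printed centred prescription
[B12] (0.3)–(0.4) (`BlockAveraging.avgFun ℰ`, any small-loop average `ℰ`) and the CENTRE reflection
`GaugeField.creflect ρ`, (γ) is ALREADY the tree theorem `BlockAveraging.avgFun_creflect` (pv26's shape
`AvgReflEquivariant`); (LOC) needs the two-block locality of (0.4) in the BOTH-ENDPOINTS form — ALSO a tree theorem
(`T4ReflectionConeSharp.twoBlockLocal_blockAvg`).  This file does the packaging into W3d's binder shapes; both
mathematical inputs are the tree's.  TWO RESIDUAL QUALIFICATIONS, VERBATIM (owner GO l.15147): **(a) the typing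
identification «`avgFun ℰ` is Bałaban's (0.4)» is T-class, as everywhere in the cell** (the tree's `BlockAveraging`
header states what of (0.4)–(0.7) it types and what it does not); **(b) the located interface gap: the one-endpoint
axiom `Setup.Averaging.local_dep` («`Ū(c)` depends only on bonds ISSUING from `B(c₋) ∪ B(c₊)`») does NOT give
`Measurable[mP]` at the cut-adjacent blocks** (a fine bond issuing from the last positive slice across the cut is not a
positive bond) — hence (L2) both-endpoints = the tree's PROPERTY `T4ReflectionConeSharp.TwoBlockLocal av` (not an axiom
of `Setup`), which the tree PROVES for `blockAvg ℰ` (`twoBlockLocal_blockAvg` ∕ `avgFun_congr₂`: the contours of (0.4)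
stay inside `B(c₋) ∪ B(c₊)`) and for the axial average (`twoBlockLocal_axial`); consumed here BY NAME.

WHAT.
* §2 For ANY one-step averaging `av : Setup.Averaging P j G`: W3d's data `posRead ρ av` (= `f`, the coarse variables on
  the positive coarse bonds), `crossRead ρ av` (= `g`, on the crossing coarse bonds), `crossRefl ρ` (= `τ`, the centre
  reflection read on crossing-bond data), their measurability, `crossRefl_comp_self`; **(iii) `crossRead_semiconj`**
  from (R) `∀ U, av.avg (U.creflect ρ) = (av.avg U).creflect ρ` (the shape `AvgReflEquivariant` at one level); **(i)
  `measurable_posRead_mPos`** from (L2) `TwoBlockLocal av`; `posRead_creflect` (the reflected partner reads the NEGATIVE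
  bonds).
* §3 THE INSTANCE `av := blockAvg ℰ` (tree `twoBlockLocal_blockAvg`, `blockAvg_creflect`, `measurable_avgFun`):
  `measurable_posRead_blockAvg_mPos`, `crossRead_blockAvg_semiconj`.
* §4 **`rpPackage_level_of_local_equivariant`** (abstract `av`) and **`isReflectionPositiveBdd_level_blockAvg`** (the
  instance): W3d's theorem with (i), (iii), `Measurable θ∕f∕g∕τ`, `θ ∘ θ = id`, `τ ∘ τ = id` DISCHARGED — only the base
  state's `MeasurePreserving (creflect ρ) μ μ` and `IsReflectionPositiveBdd μ (mPos G j ρ) (creflect ρ)` remain binders.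

HONEST SCOPE.  Discharged: (γ)∕(VAR) and (LOC)-for-averages, for the tree's CENTRED typing of (0.4), at ONE level, for
the ONE centre cut per axis (other cuts: sub-row W3g «W-CUTS» `HistoryRPAveragingCuts`, leaf-02 g8).  Displayed as before: the base RP-package in the `Setup` vocabulary
(level 0 = sub-row W3h `HistoryRPGibbs`, leaf-06 g5: W3c's `rpPackage_wilson_theta` transported along
`TorusReflectionPositivity.ofConfig`; level ≥ 1 = the iterate, whose carrier re-assembly `(Y × Y) × Z ≃ GaugeField P (j+1) G`
is not done here — W3b's abstract `rpPackage_level` iterates), the identification of W4b′'s per-cutoff carrier∕state with the tower law, (EXT)∕(LOC)-for-events, (R-sym),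
(U1)∕(G2).  Nothing here speaks to the superseded CORNER prescription of [B5] (1.6)–(1.7) ∕ [B7] (15) ((11c) as
re-attributed by R-OWNER-23-8; tree `Averaging.not_reflect_equivariant`).  NE7b NOT proved; spine 0∕9.  HONEST DEPENDENCY
(cell): continuum YM on T⁴ ⇐ BetaPertH ∧ nine spine estimates (0/9 proved); BetaPertH ⇐ (D1) ∧ (D4) ∧ CAP+tail; G-an2-4
gates asym, D1 and NE2/3/4.  This file changes none of it. -/

open MeasureTheory ProbabilityTheory
open Literature.MathematicalPhysics.QuantumFieldTheory.Balaban1983to89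
open Literature.MathematicalPhysics.QuantumFieldTheory.LatticeRP (IsReflectionPositiveBdd)
open T4Continuum BlockAveraging AveragingRT T4ReflectionConeSharp
open Summit.QuantumFields.BalabanUV.T4Continuum.HistoryRPHalfTorus

namespace Summit.QuantumFields.BalabanUV.T4Continuum.HistoryRPAveraging

noncomputable section

variable {P : Params} {j : ℕ}

/-! ## §2 W3d's data for an abstract one-step averaging, and the two sentences -/

section Abstract

variable {G : Type*} [GaugeGroup G] (ρ : Fin P.d) (av : Averaging P j G)

/-- **`f`**: the POSITIVE-HALF READ-OUT of the averaged field (the coarse variables on the positive coarse bonds). -/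
def posRead (U : GaugeField P j G) : ↥(posBonds P (j + 1) ρ) → G := fun c => av.avg U c.1

/-- **`g`**: the CROSSING READ-OUT of the averaged field (the coarse variables on the crossing coarse bonds; the pair
coordinates are not used). -/
def crossRead (p : GaugeField P j G × ((↥(posBonds P (j + 1) ρ) → G) × (↥(posBonds P (j + 1) ρ) → G))) :
    ↥(crossBonds P (j + 1) ρ) → G := fun c => av.avg p.1 c.1

/-- **`τ`**: THE CENTRE REFLECTION READ ON CROSSING-BOND DATA, `(τ z)(c) = z(c_ρ c)^{∓1}`. -/
def crossRefl (z : ↥(crossBonds P (j + 1) ρ) → G) : ↥(crossBonds P (j + 1) ρ) → G := fun c =>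
  if c.1.dir = ρ then (z ⟨cbond ρ c.1, (cbond_mem_crossBonds ρ c.1).2 c.2⟩)⁻¹
  else z ⟨cbond ρ c.1, (cbond_mem_crossBonds ρ c.1).2 c.2⟩

/-- `posRead` evaluated. [folklore] -/
@[simp] theorem posRead_apply (U : GaugeField P j G) (c : ↥(posBonds P (j + 1) ρ)) :
    posRead ρ av U c = av.avg U c.1 := rfl

/-- `crossRead` evaluated. [folklore] -/
@[simp] theorem crossRead_apply
    (p : GaugeField P j G × ((↥(posBonds P (j + 1) ρ) → G) × (↥(posBonds P (j + 1) ρ) → G)))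
    (c : ↥(crossBonds P (j + 1) ρ)) : crossRead ρ av p c = av.avg p.1 c.1 := rfl

/-- `τ` is an involution. [folklore] -/
theorem crossRefl_crossRefl (z : ↥(crossBonds P (j + 1) ρ) → G) : crossRefl ρ (crossRefl ρ z) = z := by
  funext c
  have hc : (⟨cbond ρ (cbond ρ c.1), (cbond_mem_crossBonds ρ (cbond ρ c.1)).2
      ((cbond_mem_crossBonds ρ c.1).2 c.2)⟩ : ↥(crossBonds P (j + 1) ρ)) = c := Subtype.ext (cbond_cbond ρ c.1)
  by_cases h : c.1.dir = ρ
  · have h' : (cbond ρ c.1).dir = ρ := h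
    simp only [crossRefl, h, h', if_true, inv_inv, hc]
  · have h' : ¬ (cbond ρ c.1).dir = ρ := h
    simp only [crossRefl, h, h', if_false, hc]

/-- `τ ∘ τ = id` (W3b's binder). [folklore] -/
theorem crossRefl_comp_self : crossRefl (P := P) (j := j) (G := G) ρ ∘ crossRefl ρ = id :=
  funext (crossRefl_crossRefl ρ)

/-- `τ` is measurable (W3b's binder). [folklore] -/
theorem measurable_crossRefl [MeasurableSpace G] [MeasurableInv G] :
    Measurable (crossRefl (P := P) (j := j) (G := G) ρ) := by
  refine measurable_pi_lambda _ fun c => ?_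
  by_cases h : c.1.dir = ρ
  · simp only [crossRefl, h, if_true]
    exact (measurable_pi_apply _).inv
  · simp only [crossRefl, h, if_false]
    exact measurable_pi_apply _

/-- `f` is measurable when `av.avg` is. [folklore] -/
theorem measurable_posRead [MeasurableSpace G] (hA : Measurable av.avg) : Measurable (posRead ρ av) :=
  measurable_pi_lambda _ fun c => (measurable_pi_apply c.1).comp hA

/-- `g` is measurable when `av.avg` is. [folklore] -/
theorem measurable_crossRead [MeasurableSpace G] (hA : Measurable av.avg) : Measurable (crossRead ρ av) :=
  measurable_pi_lambda _ fun c => ((measurable_pi_apply c.1).comp hA).comp measurable_fst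

/-- **(iii) = (γ): THE CROSSING AVERAGES INTERTWINE THE REFLECTIONS**, `g (c_ρ U, swap) = τ (g (U, ·))`, from the
centre-reflection equivariance of the averaging map `av.avg (c_ρ U) = c_ρ (av.avg U)` (W3d's `hsemi`). [folklore] -/
theorem crossRead_semiconj (hR : ∀ U : GaugeField P j G, av.avg (U.creflect ρ) = (av.avg U).creflect ρ)
    (p : GaugeField P j G × ((↥(posBonds P (j + 1) ρ) → G) × (↥(posBonds P (j + 1) ρ) → G))) :
    crossRead ρ av (p.1.creflect ρ, p.2.swap) = crossRefl ρ (crossRead ρ av p) := by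
  funext c
  show av.avg (p.1.creflect ρ) c.1 = _
  rw [hR, creflect_apply]
  rfl

/-- For the record, the reflected partner `f ∘ c_ρ` READS THE NEGATIVE BONDS: `f (c_ρ U) c = (av.avg U)(c_ρ c)^{∓1}`
with `c_ρ c` a negative bond (`cbond_mem_posBonds`). [folklore] -/
theorem posRead_creflect (hR : ∀ U : GaugeField P j G, av.avg (U.creflect ρ) = (av.avg U).creflect ρ)
    (U : GaugeField P j G) (c : ↥(posBonds P (j + 1) ρ)) :
    posRead ρ av (U.creflect ρ) c = if c.1.dir = ρ then (av.avg U (cbond ρ c.1))⁻¹ else av.avg U (cbond ρ c.1) := by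
  show av.avg (U.creflect ρ) c.1 = _
  rw [hR, creflect_apply]

/-- **(i) = (LOC), dependence form**: under TWO-BLOCK LOCALITY of `av` (tree `TwoBlockLocal`, both endpoints), the
average on a positive coarse bond depends only on the positive fine bonds (standing range: positivity is read on
blocks). [folklore] -/
theorem dependsOn_of_twoBlockLocal (hj : j + 1 ≤ P.m + P.K) (hL : TwoBlockLocal av) {c : PBond P (j + 1)}
    (hc : c ∈ posBonds P (j + 1) ρ) :
    DependsOn (fun U => av.avg U c) ((posBonds P j ρ : Finset (PBond P j)) : Set (PBond P j)) := by
  intro U U' hUU'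
  refine hL hj U U' c fun b hs ht => hUU' b (Finset.mem_coe.2 ?_)
  rw [mem_posBonds] at hc ⊢
  have hpos : ∀ x : Site P j, (blockOf x = c.src ∨ blockOf x = c.tgt) → (x ρ).val < P.sitesPerDir j / 2 := by
    intro x hx
    rw [← blockOf_pos_iff hj x ρ]
    rcases hx with h | h
    · rw [h]; exact hc.1
    · rw [h]; exact hc.2
  exact ⟨hpos _ hs, hpos _ ht⟩

/-- **(i) = (LOC): THE POSITIVE-HALF AVERAGES READ POSITIVE-HALF FINE VARIABLES** — `Measurable[mPos] f` (W3d's `hfP`),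
for a measurable, two-block-local `av`. [folklore] -/
theorem measurable_posRead_mPos [MeasurableSpace G] (hj : j + 1 ≤ P.m + P.K) (hA : Measurable av.avg)
    (hL : TwoBlockLocal av) : Measurable[mPos G j ρ] (posRead ρ av) :=
  @measurable_pi_lambda _ _ _ (mPos G j ρ) _ _ fun c =>
    measurable_mPos_of_dependsOn G ((measurable_pi_apply c.1).comp hA) (dependsOn_of_twoBlockLocal ρ av hj hL c.2)

end Abstract

/-! ## §3 The instance: Bałaban's block averaging (0.4), `BlockAveraging.blockAvg ℰ` -/

section Instance

variable {G : Type*} [GaugeGroup G] (ℰ : LoopAverage G)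

/-- (LOC) for (0.4): the positive-half read-out of `blockAvg ℰ` is `mPos`-measurable (tree `twoBlockLocal_blockAvg`,
`measurable_avgFun`). [folklore] -/
theorem measurable_posRead_blockAvg_mPos [MeasurableSpace G] [RegularGaugeGroup G] (hj : j + 1 ≤ P.m + P.K)
    (hE : ∀ n, Measurable fun W : Fin (n + 1) → G => ℰ.E W) (ρ : Fin P.d) :
    Measurable[mPos G j ρ] (posRead ρ (blockAvg (P := P) (j := j) ℰ)) :=
  measurable_posRead_mPos ρ _ hj (measurable_avgFun ℰ hE) (twoBlockLocal_blockAvg ℰ)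

/-- (γ) for (0.4): the crossing read-out of `blockAvg ℰ` intertwines the reflections (tree `blockAvg_creflect`). [folklore] -/
theorem crossRead_blockAvg_semiconj (ρ : Fin P.d)
    (p : GaugeField P j G × ((↥(posBonds P (j + 1) ρ) → G) × (↥(posBonds P (j + 1) ρ) → G))) :
    crossRead ρ (blockAvg (P := P) (j := j) ℰ) (p.1.creflect ρ, p.2.swap) =
      crossRefl ρ (crossRead ρ (blockAvg (P := P) (j := j) ℰ) p) :=
  crossRead_semiconj ρ _ (blockAvg_creflect ℰ ρ) p

end Instance

/-! ## §4 The one-level RP-package with (i) and (iii) discharged -/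

section Level

variable {G : Type*} [GaugeGroup G] [MeasurableSpace G]

/-- **ONE LEVEL OF THE (RP-ext) CHAIN FOR A TWO-BLOCK-LOCAL, CENTRE-REFLECTION-EQUIVARIANT AVERAGING**: W3d's
`rpPackage_level_deterministic` with `θ := c_ρ` (fine), `mP := mPos G j ρ`, `f := posRead ρ av`, `g := crossRead ρ av`,
`τ := crossRefl ρ`, and its hypotheses `Measurable θ`, `θ ∘ θ = id`, `Measurable f∕g∕τ`, `τ ∘ τ = id`,
(i) `Measurable[mP] f`, (iii) `hsemi` ALL DISCHARGED from: `av.avg` measurable, `TwoBlockLocal av`, centre-reflection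
equivariant.  Remaining binders: the base state `μ` is `c_ρ`-invariant and reflection positive on `mPos`. [folklore] -/
theorem rpPackage_level_of_local_equivariant [MeasurableInv G] (hj : j + 1 ≤ P.m + P.K) (ρ : Fin P.d)
    {av : Averaging P j G} (hA : Measurable av.avg) (hL : TwoBlockLocal av)
    (hR : ∀ U : GaugeField P j G, av.avg (U.creflect ρ) = (av.avg U).creflect ρ)
    {μ : Measure (GaugeField P j G)} [IsFiniteMeasure μ]
    (hθ : MeasurePreserving (GaugeField.creflect ρ) μ μ)
    (hRP : IsReflectionPositiveBdd μ (mPos G j ρ) (GaugeField.creflect ρ)) :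
    (((mPos G j ρ).prod (inferInstance : MeasurableSpace (↥(posBonds P (j + 1) ρ) → G))).comap
          (fun p : GaugeField P j G × ((↥(posBonds P (j + 1) ρ) → G) × (↥(posBonds P (j + 1) ρ) → G)) =>
            (p.1, p.2.1))).comap Prod.fst ≤
        (inferInstance : MeasurableSpace
          ((GaugeField P j G × ((↥(posBonds P (j + 1) ρ) → G) × (↥(posBonds P (j + 1) ρ) → G))) ×
            (↥(crossBonds P (j + 1) ρ) → G))) ∧
      Measurable (fun q : (GaugeField P j G × ((↥(posBonds P (j + 1) ρ) → G) × (↥(posBonds P (j + 1) ρ) → G))) ×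
          (↥(crossBonds P (j + 1) ρ) → G) => ((q.1.1.creflect ρ, q.1.2.swap), crossRefl ρ q.2)) ∧
      MeasurePreserving
        (fun q : (GaugeField P j G × ((↥(posBonds P (j + 1) ρ) → G) × (↥(posBonds P (j + 1) ρ) → G))) ×
          (↥(crossBonds P (j + 1) ρ) → G) => ((q.1.1.creflect ρ, q.1.2.swap), crossRefl ρ q.2))
        ((μ ⊗ₘ ((Kernel.deterministic (posRead ρ av) (measurable_posRead ρ av hA)) ×ₖ
            (Kernel.deterministic (posRead ρ av) (measurable_posRead ρ av hA)).comap (GaugeField.creflect ρ)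
              (measurable_creflect ρ))) ⊗ₘ
          Kernel.deterministic (crossRead ρ av) (measurable_crossRead ρ av hA))
        ((μ ⊗ₘ ((Kernel.deterministic (posRead ρ av) (measurable_posRead ρ av hA)) ×ₖ
            (Kernel.deterministic (posRead ρ av) (measurable_posRead ρ av hA)).comap (GaugeField.creflect ρ)
              (measurable_creflect ρ))) ⊗ₘ
          Kernel.deterministic (crossRead ρ av) (measurable_crossRead ρ av hA)) ∧
      ((fun q : (GaugeField P j G × ((↥(posBonds P (j + 1) ρ) → G) × (↥(posBonds P (j + 1) ρ) → G))) ×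
          (↥(crossBonds P (j + 1) ρ) → G) => ((q.1.1.creflect ρ, q.1.2.swap), crossRefl ρ q.2)) ∘
          (fun q : (GaugeField P j G × ((↥(posBonds P (j + 1) ρ) → G) × (↥(posBonds P (j + 1) ρ) → G))) ×
            (↥(crossBonds P (j + 1) ρ) → G) => ((q.1.1.creflect ρ, q.1.2.swap), crossRefl ρ q.2)) = id) ∧
      IsReflectionPositiveBdd
        ((μ ⊗ₘ ((Kernel.deterministic (posRead ρ av) (measurable_posRead ρ av hA)) ×ₖ
            (Kernel.deterministic (posRead ρ av) (measurable_posRead ρ av hA)).comap (GaugeField.creflect ρ)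
              (measurable_creflect ρ))) ⊗ₘ
          Kernel.deterministic (crossRead ρ av) (measurable_crossRead ρ av hA))
        ((((mPos G j ρ).prod (inferInstance : MeasurableSpace (↥(posBonds P (j + 1) ρ) → G))).comap
          (fun p : GaugeField P j G × ((↥(posBonds P (j + 1) ρ) → G) × (↥(posBonds P (j + 1) ρ) → G)) =>
            (p.1, p.2.1))).comap Prod.fst)
        (fun q : (GaugeField P j G × ((↥(posBonds P (j + 1) ρ) → G) × (↥(posBonds P (j + 1) ρ) → G))) ×
          (↥(crossBonds P (j + 1) ρ) → G) => ((q.1.1.creflect ρ, q.1.2.swap), crossRefl ρ q.2)) :=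
  HistoryRPDeterministic.rpPackage_level_deterministic (mPos_le G j ρ) (measurable_creflect ρ) hθ
    (creflect_comp_self ρ) hRP (measurable_posRead ρ av hA) (measurable_posRead_mPos ρ av hj hA hL)
    (measurable_crossRead ρ av hA) (measurable_crossRefl ρ) (crossRefl_comp_self ρ) (crossRead_semiconj ρ av hR)

/-- **ONE LEVEL OF THE (RP-ext) CHAIN FOR BAŁABAN'S BLOCK AVERAGING (0.4)** (`blockAvg ℰ`, any small-loop average `ℰ`
with measurable `E`): the RP-package of the δ-extended one-level state from the base package at the centre cut of
direction `ρ` — (LOC) and (γ) DISCHARGED (tree `twoBlockLocal_blockAvg`, `blockAvg_creflect`); displayed: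
`c_ρ`-invariance and reflection positivity on `mPos` of the base state `μ`.  Stated as the fifth member (RP); the other
four members are structural and come with `rpPackage_level_of_local_equivariant`. [folklore] -/
theorem isReflectionPositiveBdd_level_blockAvg [RegularGaugeGroup G] (hj : j + 1 ≤ P.m + P.K) (ρ : Fin P.d)
    (ℰ : LoopAverage G) (hE : ∀ n, Measurable fun W : Fin (n + 1) → G => ℰ.E W)
    {μ : Measure (GaugeField P j G)} [IsFiniteMeasure μ]
    (hθ : MeasurePreserving (GaugeField.creflect ρ) μ μ)
    (hRP : IsReflectionPositiveBdd μ (mPos G j ρ) (GaugeField.creflect ρ)) :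
    IsReflectionPositiveBdd
      ((μ ⊗ₘ ((Kernel.deterministic (posRead ρ (blockAvg (P := P) (j := j) ℰ))
            (measurable_posRead ρ _ (measurable_avgFun ℰ hE))) ×ₖ
          (Kernel.deterministic (posRead ρ (blockAvg (P := P) (j := j) ℰ))
            (measurable_posRead ρ _ (measurable_avgFun ℰ hE))).comap
            (GaugeField.creflect ρ) (measurable_creflect ρ))) ⊗ₘ
        Kernel.deterministic (crossRead ρ (blockAvg (P := P) (j := j) ℰ))
          (measurable_crossRead ρ _ (measurable_avgFun ℰ hE)))
      ((((mPos G j ρ).prod (inferInstance : MeasurableSpace (↥(posBonds P (j + 1) ρ) → G))).comap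
        (fun p : GaugeField P j G × ((↥(posBonds P (j + 1) ρ) → G) × (↥(posBonds P (j + 1) ρ) → G)) =>
          (p.1, p.2.1))).comap Prod.fst)
      (fun q : (GaugeField P j G × ((↥(posBonds P (j + 1) ρ) → G) × (↥(posBonds P (j + 1) ρ) → G))) ×
        (↥(crossBonds P (j + 1) ρ) → G) => ((q.1.1.creflect ρ, q.1.2.swap), crossRefl ρ q.2)) :=
  (rpPackage_level_of_local_equivariant hj ρ (measurable_avgFun ℰ hE) (twoBlockLocal_blockAvg ℰ)
    (blockAvg_creflect ℰ ρ) hθ hRP).2.2.2.2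

end Level

end

end Summit.QuantumFields.BalabanUV.T4Continuum.HistoryRPAveraging
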